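import Literature.Geometry.Riemannian.SphericalCylinderEntropy

/-!
# Helper for stub 4 (`stub_groundStateContinuity`) of line `conformal-kernel-domination` (crux stmt-SmoothPoincare4-7632):
# the shadow of an end-separating set dominates the slice measure SETWISE.

refuter-drefute-stmt-SmoothPoincare4-7632-0 (positive helper, evidence for the prover; not landed by the refuter).

The tree's area floor `hausdorffMeasure_sphere_le_of_separatesEnds` (`μH[4](S⁴) ≤ μH[4](A)` for `A ⊆ N`
separating the ends) localises: for EVERY `B ⊆ S⁴`, `μH[4](B) ≤ μH[4](A ∩ truncL⁻¹(B))`, because the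
1-Lipschitz truncation maps `A ∩ truncL⁻¹(B)` onto a superset of `B`.  As measures on `ℝ⁵`:
`μH[4]⌊S⁴ ≤ truncL_# (μH[4]⌊A)`.  Together with `μH[4](A) ≤ (1+ε) μH[4](S⁴)` this pins the shadow of a
thin cross-section down to `slice measure + (mass ≤ ε μH[4](S⁴))`, which is the heart of the elementary
proof of `GroundStateContinuity` (see Negative-notes-GroundStateContinuity.md).
-/

noncomputable section

open MeasureTheory Set
open Literature.Geometry.Riemannian.SphericalCylinderEntropy

namespace DrefuteCKD

local notation "E5" => EuclideanSpace ℝ (Fin 5)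
local notation "E6" => EuclideanSpace ℝ (Fin 6)

/-- **The shadow of an end-separating set covers the sphere** (the covering step inside the tree's
`hausdorffMeasure_sphere_le_of_separatesEnds`, exported). -/
theorem sphere_subset_truncL_image {A : Set E6} {R : ℝ}
    (hR : ∀ a b : E6, ∑ i : Fin 5, a (Fin.castSucc i) ^ 2 = 1 →
      ∑ i : Fin 5, b (Fin.castSucc i) ^ 2 = 1 → a 5 ≤ -R → R ≤ b 5 →
        ¬ JoinedIn ({z : E6 | ∑ i : Fin 5, z (Fin.castSucc i) ^ 2 = 1} \ A) a b) :
    Metric.sphere (0 : E5) 1 ⊆ truncL '' A := by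
  intro q hq
  by_contra hmiss
  have hq1 : ∑ i : Fin 5, q i ^ 2 = 1 := by
    have h1 : ‖q‖ = 1 := mem_sphere_zero_iff_norm.mp hq
    have h2 := EuclideanSpace.norm_sq_eq q
    rw [h1, one_pow] at h2
    simpa [Real.norm_eq_abs, sq_abs] using h2.symm
  let e : ℝ → E6 := fun h => (EuclideanSpace.equiv (Fin 6) ℝ).symm (Fin.snoc (fun i : Fin 5 => q i) h)
  have he_cast : ∀ h (i : Fin 5), e h (Fin.castSucc i) = q i := by
    intro h i; simp [e]
  have he_last : ∀ h, e h 5 = h := by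
    intro h
    have h1 : Fin.snoc (α := fun _ : Fin 6 => ℝ) (fun i : Fin 5 => q i) h (Fin.last 5) = h :=
      Fin.snoc_last _ _
    simpa [e] using h1
  have hmemN : ∀ h, ∑ i : Fin 5, e h (Fin.castSucc i) ^ 2 = 1 := by
    intro h; simp only [he_cast]; exact hq1
  have hseg : segment ℝ (e (-(|R| + 1))) (e (|R| + 1)) ⊆
      {z : E6 | ∑ i : Fin 5, z (Fin.castSucc i) ^ 2 = 1} \ A := by
    rintro w ⟨a, b, ha, hb, hab, rfl⟩
    have hw : ∀ i : Fin 5, (a • e (-(|R| + 1)) + b • e (|R| + 1)) (Fin.castSucc i) = q i := by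
      intro i
      simp only [PiLp.add_apply, PiLp.smul_apply, smul_eq_mul, he_cast]
      rw [← add_mul, hab, one_mul]
    refine ⟨by simp only [Set.mem_setOf_eq, hw]; exact hq1, fun hwA => hmiss ⟨_, hwA, ?_⟩⟩
    ext i
    rw [truncL_apply, hw]
  exact hR _ _ (hmemN _) (hmemN _) (by rw [he_last]; linarith [le_abs_self R])
    (by rw [he_last]; linarith [le_abs_self R]) (JoinedIn.of_segment_subset hseg)

/-- **Localised area floor.** If `A` separates the ends of `N` then for every `B ⊆ S⁴`,
`μH[4](B) ≤ μH[4](A ∩ truncL⁻¹(B))`. -/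
theorem hausdorffMeasure_le_inter_preimage_of_separatesEnds {A : Set E6} {R : ℝ}
    (hR : ∀ a b : E6, ∑ i : Fin 5, a (Fin.castSucc i) ^ 2 = 1 →
      ∑ i : Fin 5, b (Fin.castSucc i) ^ 2 = 1 → a 5 ≤ -R → R ≤ b 5 →
        ¬ JoinedIn ({z : E6 | ∑ i : Fin 5, z (Fin.castSucc i) ^ 2 = 1} \ A) a b)
    {B : Set E5} (hB : B ⊆ Metric.sphere (0 : E5) 1) :
    μH[4] B ≤ μH[4] (A ∩ truncL ⁻¹' B) := by
  have hcover : B ⊆ truncL '' (A ∩ truncL ⁻¹' B) := by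
    intro q hq
    obtain ⟨a, ha, rfl⟩ := sphere_subset_truncL_image hR (hB hq)
    exact ⟨a, ⟨ha, hq⟩, rfl⟩
  calc μH[4] B ≤ μH[4] (truncL '' (A ∩ truncL ⁻¹' B)) := measure_mono hcover
    _ ≤ (1 : ENNReal) ^ (4 : ℝ) * μH[4] (A ∩ truncL ⁻¹' B) :=
        lipschitz_truncL.hausdorffMeasure_image_le (by norm_num) _
    _ = μH[4] (A ∩ truncL ⁻¹' B) := by simp

/-- **Shadow as measures.** If `A` separates the ends of `N` then
`μH[4]⌊S⁴ ≤ truncL_# (μH[4]⌊A)` as measures on `ℝ⁵`. -/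
theorem restrict_sphere_le_map_truncL_restrict {A : Set E6} {R : ℝ}
    (hR : ∀ a b : E6, ∑ i : Fin 5, a (Fin.castSucc i) ^ 2 = 1 →
      ∑ i : Fin 5, b (Fin.castSucc i) ^ 2 = 1 → a 5 ≤ -R → R ≤ b 5 →
        ¬ JoinedIn ({z : E6 | ∑ i : Fin 5, z (Fin.castSucc i) ^ 2 = 1} \ A) a b) :
    (μH[4] : Measure E5).restrict (Metric.sphere (0 : E5) 1) ≤
      ((μH[4] : Measure E6).restrict A).map truncL := by
  refine Measure.le_iff.2 fun s hs => ?_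
  rw [Measure.restrict_apply hs, Measure.map_apply truncL.continuous.measurable hs,
    Measure.restrict_apply (hs.preimage truncL.continuous.measurable), Set.inter_comm _ A]
  calc μH[4] (s ∩ Metric.sphere (0 : E5) 1)
      ≤ μH[4] (A ∩ truncL ⁻¹' (s ∩ Metric.sphere (0 : E5) 1)) :=
        hausdorffMeasure_le_inter_preimage_of_separatesEnds hR Set.inter_subset_right
    _ ≤ μH[4] (A ∩ truncL ⁻¹' s) := by
        refine measure_mono (Set.inter_subset_inter_right _ (Set.preimage_mono Set.inter_subset_left))

end DrefuteCKD

end
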